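import Literature.NumberTheory.EllipticCurves.ModularityVersionAp
import Literature.NumberTheory.LFunctions.GL2HarmonicFamily
import Mathlib.Data.Finset.NatDivisors
import Mathlib.Data.Nat.Factorization.Induction
import Mathlib.Algebra.BigOperators.NatAntidiagonal
import HarnessLib

/-!
# Hecke multiplicativity for newforms on `Γ₀(N)`: the `d`-sum form
# `a_m a_n = Σ_{d ∣ (m,n), (d,N)=1} d^{k−1} a_{mn/d²}` and `λ_f(m) λ_f(n) = Σ_{d ∣ (m,n), (d,N)=1} λ_f(mn/d²)`

Topic `Literature/NumberTheory/ModularForms` (cell landau-siegel / ls-inputs, row H-Hecke of INPUT LIST v1.3 §1H;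
it discharges the tree's named fact `Literature.NumberTheory.LFunctions.KMV2000.kmv2000_lemma31` = Kowalski–Michel–
VanderKam 2000, Lemma 3.1 (10), in the companion file `Literature/NumberTheory/LFunctions/KMVHeckeRecursionHolds.lean`).

For a newform `f ∈ S_k(Γ₀(N))` (`IsNewform0 f`: new, eigenform of every `T_p`, `a_1 = 1`) with Fourier coefficients
`a_n = cuspCoeff f n` and every `m, n : ℕ`:

* `cuspCoeff_mul_cuspCoeff` — `a_m a_n = Σ_{d ∣ gcd(m,n), (d,N)=1} d^{k−1} a_{mn/d²}` (Hecke's multiplicativity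
  relation `T_m T_n = Σ_{d ∣ (m,n)} 𝟙_N(d) d^{k−1} T_{mn/d²}` read on a normalised eigenform; Diamond–Shurman Prop. 5.8.5
  iterated, Atkin–Lehner 1970 Thm. 3, Shimura 1971 Thm. 3.24);
* `cuspCoeff_mul_cuspCoeff_of_coprime` — the same over ALL `d ∣ gcd(m,n)` when `(gcd(m,n), N) = 1`;
* `heckeLambda_mul_heckeLambda` — in the analytic normalisation `λ_f(n) = a_n n^{−(k−1)/2}`
  (`GL2Family.heckeLambda`) the weight factor disappears: `λ_f(m) λ_f(n) = Σ_{d ∣ gcd(m,n), (d,N)=1} λ_f(mn/d²)`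
  (Kowalski–Michel–VanderKam 2000, Lemma 3.1 (10), there for `k = 2` and prime level `q`, `ε_q(d) = 𝟙_{q ∤ d}`);
  `heckeLambda_mul_heckeLambda_of_coprime`, and the prime-level reading `heckeLambda_mul_heckeLambda_primeLevel`
  (filter `¬ q ∣ d`, the literal shape of `kmv2000_lemma31`).

## Proof

Everything is derived from two PROVED tree theorems: the prime recursion
`IsNewform0.cuspCoeff_prime_mul` (`a_{pn} = a_p a_n − 𝟙_{p∤N} p^{k−1} a_{n/p}`, Diamond–Shurman Prop. 5.8.5, incl.
`U_p` for `p ∣ N`) and coprime multiplicativity `IsNewform0.coeff_mul_of_coprime_holds` (`a_{mn} = a_m a_n`,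
`(m,n) = 1`). Step 1 (one prime): `a_{p^{t+s}} a_{p^s} = Σ_{i+j=s} c_p^i a_{p^{t+2j}}` with `c_p = 𝟙_{p∤N} p^{k−1}`, by a
two-step induction on `s` over `Finset.antidiagonal` (`cuspCoeff_prime_pow_mul_prime_pow_antidiagonal`), rewritten as
a sum over the divisors of `p^{min(a,b)}` (`cuspCoeff_prime_pow_mul_prime_pow`). Step 2 (gluing): induction on `m` along
`Nat.recOnPrimePow` (`m = p^t · a`, `p ∤ a`), splitting `n = p^s · b`, `p ∤ b`; the product of the prime part and the
coprime part is re-indexed over `divisors (p^{min(t,s)} · gcd(a,b)) = divisors (gcd(m,n))` through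
`Nat.divisors_mul` and `Nat.Coprime.mul_injOn_divisors` (`sum_divisors_mul_of_coprime`). Step 3: divide by
`(mn)^{(k−1)/2} = (mn/d²)^{(k−1)/2} d^{k−1}` (`Complex.natCast_mul_natCast_cpow`).

No definition and no named fact is introduced here (the weight `𝟙_{(d,N)=1} d^{k−1}` is written as an `if`).
What is NOT here: Hecke operators themselves (`T_m` for composite `m` is not in the tree), non-trivial nebentypus,
Maass forms; the statement for `Γ₁(N)`-newforms with character `χ(d) d^{k−1}` is the obvious variant and is not typed.

## References
* [DiamondShurman2005] Prop. 5.8.5 (the prime recursions; iterated here).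
* [AtkinLehner1970] Thm. 3; [Shimura1971] Thm. 3.24, (3.5.9)–(3.5.10).
* [KowalskiMichelVanderKam2000] Lemma 3.1 (10) p. 8 («Hecke's recursion formula for primitive forms»).
-/

noncomputable section

open scoped MatrixGroups Pointwise
open CongruenceSubgroup Complex Finset
open Literature.NumberTheory.EllipticCurves.ModularForms
open Literature.NumberTheory.LFunctions (GL2Family.heckeLambda)

namespace Literature.NumberTheory.ModularForms

/-! ### Arithmetic bookkeeping: divisor sums over coprime products, the level weight `𝟙_{(d,N)=1} d^{k−1}` -/

/-- For coprime `A, B` a sum over the divisors of `A·B` is the double sum over pairs of divisors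
(`Nat.divisors_mul`, products of divisors of coprime numbers are distinct: `Nat.Coprime.mul_injOn_divisors`). [folklore] -/
private theorem sum_divisors_mul_of_coprime {M : Type*} [AddCommMonoid M] {A B : ℕ} (h : A.Coprime B) (F : ℕ → M) :
    ∑ c ∈ (A * B).divisors, F c = ∑ e ∈ A.divisors, ∑ d ∈ B.divisors, F (e * d) := by
  rw [Nat.divisors_mul, Finset.mul_def, Finset.sum_image h.mul_injOn_divisors, Finset.sum_product]

/-- The level weight `w_N(d) = 𝟙_{(d,N)=1} d^{k−1}` is completely multiplicative. [folklore] -/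
private theorem levelWeight_mul (N : ℕ) (k : ℤ) (e d : ℕ) :
    (if (e * d).Coprime N then (((e * d : ℕ) : ℂ)) ^ (k - 1) else 0) =
      (if e.Coprime N then (e : ℂ) ^ (k - 1) else 0) * (if d.Coprime N then (d : ℂ) ^ (k - 1) else 0) := by
  simp only [Nat.coprime_mul_iff_left]
  by_cases he : e.Coprime N <;> by_cases hd : d.Coprime N
  · rw [if_pos ⟨he, hd⟩, if_pos he, if_pos hd, Nat.cast_mul, mul_zpow]
  · rw [if_neg (fun h ↦ hd h.2), if_neg hd, mul_zero]
  · rw [if_neg (fun h ↦ he h.1), if_neg he, zero_mul]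
  · rw [if_neg (fun h ↦ he h.1), if_neg he, zero_mul]

/-- On powers of a prime `p` the level weight is the power of `c_p = 𝟙_{p∤N} p^{k−1}` (the constant of the tree's
prime recursion `IsNewform0.cuspCoeff_prime_mul`): `w_N(p^i) = c_p^i`. [folklore] -/
private theorem levelWeight_prime_pow {N : ℕ} (k : ℤ) {p : ℕ} (hp : p.Prime) (i : ℕ) :
    (if (p ^ i).Coprime N then (((p ^ i : ℕ) : ℂ)) ^ (k - 1) else 0) =
      (if p ∣ N then 0 else (p : ℂ) ^ (k - 1)) ^ i := by
  rcases Nat.eq_zero_or_pos i with rfl | hi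
  · simp
  · by_cases hpN : p ∣ N
    · have hnc : ¬ (p ^ i).Coprime N := fun h ↦
        hp.coprime_iff_not_dvd.mp ((Nat.coprime_pow_left_iff hi p N).mp h) hpN
      rw [if_neg hnc, if_pos hpN, zero_pow hi.ne']
    · have hc : (p ^ i).Coprime N := (Nat.coprime_pow_left_iff hi p N).mpr (hp.coprime_iff_not_dvd.mpr hpN)
      rw [if_pos hc, if_neg hpN, Nat.cast_pow, ← zpow_natCast, ← zpow_natCast, ← zpow_mul, ← zpow_mul,
        mul_comm]

/-- `gcd(p^t, p^s) = p^{min(t,s)}`. [folklore] -/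
private theorem gcd_pow_pow_eq_pow_min (p t s : ℕ) : Nat.gcd (p ^ t) (p ^ s) = p ^ min t s := by
  rcases le_total t s with h | h
  · rw [min_eq_left h, Nat.gcd_eq_left (pow_dvd_pow p h)]
  · rw [min_eq_right h, Nat.gcd_eq_right (pow_dvd_pow p h)]

/-- `gcd(p^t a, p^s b) = p^{min(t,s)} · gcd(a, b)` when `p ∤ a`, `p ∤ b` (`p` prime). [folklore] -/
private theorem gcd_prime_pow_mul {p : ℕ} (hp : p.Prime) {a b : ℕ} (ha : ¬ p ∣ a) (hb : ¬ p ∣ b) (t s : ℕ) :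
    Nat.gcd (p ^ t * a) (p ^ s * b) = p ^ min t s * Nat.gcd a b := by
  have hpa : (p ^ s).Coprime a := Nat.Coprime.pow_left s (hp.coprime_iff_not_dvd.mpr ha)
  have hpb : (p ^ s).Coprime b := Nat.Coprime.pow_left s (hp.coprime_iff_not_dvd.mpr hb)
  have hpb' : (p ^ t).Coprime b := Nat.Coprime.pow_left t (hp.coprime_iff_not_dvd.mpr hb)
  rw [Nat.Coprime.gcd_mul _ hpb, Nat.Coprime.gcd_mul_right_cancel _ hpa.symm, gcd_pow_pow_eq_pow_min,
    Nat.Coprime.gcd_mul_left_cancel _ hpb']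

/-! ### Step 1: one prime -/

section OnePrime

variable {N : ℕ} [NeZero N] {k : ℤ} {f : CuspForm (Gamma0 N) k}

/-- `a_1(f) = 1` for a newform, in `cuspCoeff` vocabulary. [cite: DiamondShurman2005, Def. 5.8.1] -/
theorem cuspCoeff_one_of_isNewform0 (hf : IsNewform0 f) : cuspCoeff f 1 = 1 := hf.2.2

/-- The prime recursion one step up, with no case distinction: `a_p a_{p^{e+1}} = a_{p^{e+2}} + c_p a_{p^e}`,
`c_p = 𝟙_{p∤N} p^{k−1}` (Diamond–Shurman Prop. 5.8.5; tree `IsNewform0.cuspCoeff_prime_mul`).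
[cite: DiamondShurman2005, Prop. 5.8.5] -/
theorem cuspCoeff_prime_mul_prime_pow_succ (hf : IsNewform0 f) {p : ℕ} (hp : p.Prime) (e : ℕ) :
    cuspCoeff f p * cuspCoeff f (p ^ (e + 1)) =
      cuspCoeff f (p ^ (e + 2)) + (if p ∣ N then 0 else (p : ℂ) ^ (k - 1)) * cuspCoeff f (p ^ e) := by
  have h := hf.cuspCoeff_prime_mul hp (p ^ (e + 1))
  have hdiv : p ^ (e + 1) / p = p ^ e := by rw [pow_succ, Nat.mul_div_cancel _ hp.pos]
  rw [← pow_succ', if_pos (dvd_pow_self p (Nat.succ_ne_zero e)), hdiv] at h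
  rw [h]
  split_ifs <;> ring

/-- One prime, antidiagonal form: `a_{p^{t+s}} a_{p^s} = Σ_{i+j=s} c_p^i a_{p^{t+2j}}` (two-step induction on `s`
from `cuspCoeff_prime_mul_prime_pow_succ`). [cite: DiamondShurman2005, Prop. 5.8.5] -/
theorem cuspCoeff_prime_pow_mul_prime_pow_antidiagonal (hf : IsNewform0 f) {p : ℕ} (hp : p.Prime) (t s : ℕ) :
    cuspCoeff f (p ^ (t + s)) * cuspCoeff f (p ^ s) =
      ∑ x ∈ antidiagonal s, (if p ∣ N then 0 else (p : ℂ) ^ (k - 1)) ^ x.1 * cuspCoeff f (p ^ (t + 2 * x.2)) := by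
  set c : ℂ := if p ∣ N then 0 else (p : ℂ) ^ (k - 1) with hc
  induction s using Nat.strong_induction_on generalizing t with
  | _ s ih =>
    rcases s with _ | _ | s
    · simp [cuspCoeff_one_of_isNewform0 hf]
    · rw [Finset.Nat.sum_antidiagonal_succ]
      simp only [Finset.Nat.antidiagonal_zero, Finset.sum_singleton, pow_zero, one_mul, zero_add, pow_one,
        mul_zero, add_zero]
      rw [mul_comm, cuspCoeff_prime_mul_prime_pow_succ hf hp t]
    · have IH1 := ih (s + 1) (by omega) (t + 1)
      have IH0 := ih s (by omega) (t + 2)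
      have hrec : cuspCoeff f (p ^ (s + 2)) = cuspCoeff f p * cuspCoeff f (p ^ (s + 1)) - c * cuspCoeff f (p ^ s) := by
        rw [cuspCoeff_prime_mul_prime_pow_succ hf hp s]; ring
      have hpush : ∀ j : ℕ, cuspCoeff f p * cuspCoeff f (p ^ (t + 1 + 2 * j)) =
          cuspCoeff f (p ^ (t + 2 + 2 * j)) + c * cuspCoeff f (p ^ (t + 2 * j)) := by
        intro j
        have h := cuspCoeff_prime_mul_prime_pow_succ hf hp (t + 2 * j)
        rw [show t + 2 * j + 1 = t + 1 + 2 * j by ring, show t + 2 * j + 2 = t + 2 + 2 * j by ring] at h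
        exact h
      have e1 : t + (s + 1 + 1) = t + 1 + (s + 1) := by ring
      have e2 : t + 1 + (s + 1) = t + 2 + s := by ring
      calc cuspCoeff f (p ^ (t + (s + 1 + 1))) * cuspCoeff f (p ^ (s + 1 + 1))
          = cuspCoeff f p * (cuspCoeff f (p ^ (t + 1 + (s + 1))) * cuspCoeff f (p ^ (s + 1))) -
              c * (cuspCoeff f (p ^ (t + 2 + s)) * cuspCoeff f (p ^ s)) := by
            rw [hrec, e1, ← e2]; ring
        _ = cuspCoeff f p * (∑ x ∈ antidiagonal (s + 1), c ^ x.1 * cuspCoeff f (p ^ (t + 1 + 2 * x.2))) -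
              c * ∑ x ∈ antidiagonal s, c ^ x.1 * cuspCoeff f (p ^ (t + 2 + 2 * x.2)) := by rw [IH1, IH0]
        _ = (∑ x ∈ antidiagonal (s + 1), c ^ x.1 * cuspCoeff f (p ^ (t + 2 + 2 * x.2)) +
              ∑ x ∈ antidiagonal (s + 1), c ^ (x.1 + 1) * cuspCoeff f (p ^ (t + 2 * x.2))) -
              ∑ x ∈ antidiagonal s, c ^ (x.1 + 1) * cuspCoeff f (p ^ (t + 2 + 2 * x.2)) := by
            rw [Finset.mul_sum, Finset.mul_sum, ← Finset.sum_add_distrib]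
            congr 1
            · refine Finset.sum_congr rfl fun x _ ↦ ?_
              rw [mul_left_comm, hpush]; ring
            · refine Finset.sum_congr rfl fun x _ ↦ ?_
              ring
        _ = ∑ x ∈ antidiagonal (s + 1 + 1), c ^ x.1 * cuspCoeff f (p ^ (t + 2 * x.2)) := by
            rw [Finset.Nat.sum_antidiagonal_succ (n := s + 1),
              Finset.Nat.sum_antidiagonal_succ (f := fun x ↦ c ^ x.1 * cuspCoeff f (p ^ (t + 2 + 2 * x.2)))]
            simp only [pow_zero, one_mul, show t + 2 + 2 * (s + 1) = t + 2 * (s + 1 + 1) by ring]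
            ring

/-- **One prime, divisor form**: `a_{p^a} a_{p^b} = Σ_{d ∣ p^{min(a,b)}} w_N(d) a_{p^{a+b}/d²}` with
`w_N(d) = 𝟙_{(d,N)=1} d^{k−1}` (Diamond–Shurman Prop. 5.8.5 iterated; for `p ∣ N` only `d = 1` survives and
`a_{p^a} a_{p^b} = a_{p^{a+b}}`). [cite: DiamondShurman2005, Prop. 5.8.5] -/
theorem cuspCoeff_prime_pow_mul_prime_pow (hf : IsNewform0 f) {p : ℕ} (hp : p.Prime) (a b : ℕ) :
    cuspCoeff f (p ^ a) * cuspCoeff f (p ^ b) =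
      ∑ d ∈ (p ^ min a b).divisors,
        (if d.Coprime N then (d : ℂ) ^ (k - 1) else 0) * cuspCoeff f (p ^ (a + b) / d ^ 2) := by
  wlog hba : b ≤ a generalizing a b
  · rw [mul_comm, this b a (le_of_not_ge hba), min_comm, add_comm]
  obtain ⟨t, rfl⟩ := Nat.exists_eq_add_of_le hba
  rw [min_eq_right hba, Nat.sum_divisors_prime_pow hp, add_comm b t,
    cuspCoeff_prime_pow_mul_prime_pow_antidiagonal hf hp t b, Finset.Nat.sum_antidiagonal_eq_sum_range_succ_mk]
  refine Finset.sum_congr rfl fun i hi ↦ ?_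
  have hib : i ≤ b := Nat.lt_succ_iff.mp (Finset.mem_range.mp hi)
  rw [levelWeight_prime_pow k hp i, ← pow_mul, Nat.pow_div (by omega) hp.pos,
    show t + b + b - i * 2 = t + 2 * (b - i) by omega]

end OnePrime

/-! ### Step 2: all `m, n` -/

section General

variable {N : ℕ} [NeZero N] {k : ℤ} {f : CuspForm (Gamma0 N) k}

/-- **Hecke multiplicativity, indicator form**: for a newform `f ∈ S_k(Γ₀(N))` and all `m, n : ℕ`,
`a_m a_n = Σ_{d ∣ gcd(m,n)} 𝟙_{(d,N)=1} d^{k−1} a_{mn/d²}` (Diamond–Shurman Prop. 5.8.5 iterated: the prime-power case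
`cuspCoeff_prime_pow_mul_prime_pow` glued along `Nat.recOnPrimePow` by coprime multiplicativity
`IsNewform0.coeff_mul_of_coprime_holds`; `m = 0` or `n = 0` hold trivially since `a_0 = 0`).
[cite: DiamondShurman2005, Prop. 5.8.5] -/
theorem cuspCoeff_mul_cuspCoeff_eq_sum_ite (hf : IsNewform0 f) (m n : ℕ) :
    cuspCoeff f m * cuspCoeff f n =
      ∑ d ∈ (m.gcd n).divisors, (if d.Coprime N then (d : ℂ) ^ (k - 1) else 0) * cuspCoeff f (m * n / d ^ 2) := by
  have h0 : cuspCoeff f 0 = 0 := cuspCoeff_zero (one_mem_strictPeriods_gamma0 N) f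
  have hmul : ∀ {u v : ℕ}, u.Coprime v → cuspCoeff f (u * v) = cuspCoeff f u * cuspCoeff f v :=
    fun huv ↦ IsNewform0.coeff_mul_of_coprime_holds hf huv
  induction m using Nat.recOnPrimePow generalizing n with
  | zero => simp [h0]
  | one => simp [cuspCoeff_one_of_isNewform0 hf]
  | prime_pow_mul a p t hp hpa ht ih =>
    rcases Nat.eq_zero_or_pos n with rfl | hn
    · simp [h0]
    obtain ⟨s, b, hpb, rfl⟩ := Nat.exists_eq_pow_mul_and_not_dvd hn.ne' p hp.ne_one
    have hcopa : (p ^ t).Coprime a := Nat.Coprime.pow_left t (hp.coprime_iff_not_dvd.mpr hpa)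
    have hcopb : (p ^ s).Coprime b := Nat.Coprime.pow_left s (hp.coprime_iff_not_dvd.mpr hpb)
    have hcop : (p ^ min t s).Coprime (Nat.gcd a b) :=
      Nat.Coprime.coprime_dvd_right (Nat.gcd_dvd_left a b) (Nat.Coprime.pow_left _ (hp.coprime_iff_not_dvd.mpr hpa))
    rw [gcd_prime_pow_mul hp hpa hpb, sum_divisors_mul_of_coprime hcop, hmul hcopa, hmul hcopb,
      show cuspCoeff f (p ^ t) * cuspCoeff f a * (cuspCoeff f (p ^ s) * cuspCoeff f b) =
        (cuspCoeff f (p ^ t) * cuspCoeff f (p ^ s)) * (cuspCoeff f a * cuspCoeff f b) by ring,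
      cuspCoeff_prime_pow_mul_prime_pow hf hp t s, ih b, Finset.sum_mul_sum]
    refine Finset.sum_congr rfl fun e he ↦ Finset.sum_congr rfl fun d hd ↦ ?_
    have hep : e ∣ p ^ min t s := Nat.dvd_of_mem_divisors he
    have hdg : d ∣ Nat.gcd a b := Nat.dvd_of_mem_divisors hd
    have he2 : e ^ 2 ∣ p ^ (t + s) := by
      refine (pow_dvd_pow_of_dvd hep 2).trans ?_
      rw [← pow_mul]
      exact pow_dvd_pow p (by omega)
    have hd2 : d ^ 2 ∣ a * b := by
      rw [sq]; exact Nat.mul_dvd_mul (hdg.trans (Nat.gcd_dvd_left a b)) (hdg.trans (Nat.gcd_dvd_right a b))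
    -- the two quotients are coprime: a `p`-power and a divisor of `a b`
    have hq : (p ^ (t + s) / e ^ 2).Coprime (a * b / d ^ 2) := by
      have h1 : (p ^ (t + s)).Coprime (a * b) :=
        Nat.Coprime.pow_left _ (Nat.Coprime.mul_right (hp.coprime_iff_not_dvd.mpr hpa)
          (hp.coprime_iff_not_dvd.mpr hpb))
      exact Nat.Coprime.coprime_dvd_left (Nat.div_dvd_of_dvd he2)
        (Nat.Coprime.coprime_dvd_right (Nat.div_dvd_of_dvd hd2) h1)
    rw [levelWeight_mul N k e d, show p ^ t * a * (p ^ s * b) = p ^ (t + s) * (a * b) by ring, mul_pow,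
      ← Nat.div_mul_div_comm he2 hd2, hmul hq]
    ring

/-- **Hecke multiplicativity for newforms on `Γ₀(N)` (d-sum form).** For a newform `f ∈ S_k(Γ₀(N))`
(`IsNewform0 f`) and all `m, n : ℕ`: `a_m(f) a_n(f) = Σ_{d ∣ gcd(m,n), (d,N)=1} d^{k−1} a_{mn/d²}(f)` — the relation
`T_m T_n = Σ_{d∣(m,n)} 𝟙_N(d) d^{k−1} T_{mn/d²}` on a normalised eigenform (Diamond–Shurman Prop. 5.8.5 iterated;
Atkin–Lehner 1970 Thm. 3; Shimura 1971 Thm. 3.24). Special cases: `(m,n) = 1` gives `a_{mn} = a_m a_n`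
(`IsNewform0.coeff_mul_of_coprime_holds`); `m = p` prime gives `IsNewform0.cuspCoeff_prime_mul`.
[cite: DiamondShurman2005, Prop. 5.8.5] -/
theorem cuspCoeff_mul_cuspCoeff (hf : IsNewform0 f) (m n : ℕ) :
    cuspCoeff f m * cuspCoeff f n =
      ∑ d ∈ (m.gcd n).divisors with d.Coprime N, (d : ℂ) ^ (k - 1) * cuspCoeff f (m * n / d ^ 2) := by
  rw [Finset.sum_filter, cuspCoeff_mul_cuspCoeff_eq_sum_ite hf m n]
  exact Finset.sum_congr rfl fun d _ ↦ by split_ifs <;> simp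

/-- When `gcd(m,n)` is prime to the level (e.g. `(mn, N) = 1`) the coprimality condition is void:
`a_m a_n = Σ_{d ∣ gcd(m,n)} d^{k−1} a_{mn/d²}`. [cite: DiamondShurman2005, Prop. 5.8.5] -/
theorem cuspCoeff_mul_cuspCoeff_of_coprime (hf : IsNewform0 f) {m n : ℕ} (hmn : (m.gcd n).Coprime N) :
    cuspCoeff f m * cuspCoeff f n = ∑ d ∈ (m.gcd n).divisors, (d : ℂ) ^ (k - 1) * cuspCoeff f (m * n / d ^ 2) := by
  rw [cuspCoeff_mul_cuspCoeff hf, Finset.filter_true_of_mem]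
  exact fun d hd ↦ Nat.Coprime.coprime_dvd_left (Nat.dvd_of_mem_divisors hd) hmn

/-- Weight `2`: `a_m a_n = Σ_{d ∣ gcd(m,n), (d,N)=1} d · a_{mn/d²}` (Diamond–Shurman Prop. 5.8.5, `k = 2`).
[cite: DiamondShurman2005, Prop. 5.8.5] -/
theorem cuspCoeff_mul_cuspCoeff_weight_two {f : CuspForm (Gamma0 N) 2} (hf : IsNewform0 f) (m n : ℕ) :
    cuspCoeff f m * cuspCoeff f n =
      ∑ d ∈ (m.gcd n).divisors with d.Coprime N, (d : ℂ) * cuspCoeff f (m * n / d ^ 2) := by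
  rw [cuspCoeff_mul_cuspCoeff hf m n]
  exact Finset.sum_congr rfl fun d _ ↦ by rw [show (2 : ℤ) - 1 = 1 by norm_num, zpow_one]

/-! ### Step 3: the analytic normalisation `λ_f(n) = a_n n^{−(k−1)/2}` -/

/-- Renormalisation bookkeeping: for `d ∣ m`, `d ∣ n`, `d ≠ 0`,
`d^{k−1} (mn)^{−(k−1)/2} = (mn/d²)^{−(k−1)/2}`. [folklore] -/
private theorem zpow_mul_natCast_mul_cpow_eq (k : ℤ) {m n d : ℕ} (hd : d ≠ 0) (hdm : d ∣ m) (hdn : d ∣ n) :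
    (d : ℂ) ^ (k - 1) * (((m * n : ℕ) : ℂ) ^ (-(((k : ℂ) - 1) / 2))) =
      ((m * n / d ^ 2 : ℕ) : ℂ) ^ (-(((k : ℂ) - 1) / 2)) := by
  have hd2 : d ^ 2 ∣ m * n := by rw [sq]; exact Nat.mul_dvd_mul hdm hdn
  have hdC : (d : ℂ) ≠ 0 := Nat.cast_ne_zero.mpr hd
  conv_lhs => rw [← Nat.div_mul_cancel hd2, Nat.cast_mul, Complex.natCast_mul_natCast_cpow, Nat.cast_pow,
    ← Complex.natCast_cpow_natCast_mul]
  rw [show ((2 : ℕ) : ℂ) * (-(((k : ℂ) - 1) / 2)) = ((-(k - 1) : ℤ) : ℂ) by push_cast; ring,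
    Complex.cpow_intCast, zpow_neg, mul_comm, mul_assoc, inv_mul_cancel₀ (zpow_ne_zero _ hdC), mul_one]

/-- **Hecke multiplicativity in the analytic normalisation** (Kowalski–Michel–VanderKam 2000, Lemma 3.1 (10), there
for weight `2` and prime level; here any weight `k` and level `N`): for a newform `f ∈ S_k(Γ₀(N))` and all `m, n : ℕ`,
`λ_f(m) λ_f(n) = Σ_{d ∣ gcd(m,n), (d,N)=1} λ_f(mn/d²)` with `λ_f(n) = a_n(f) n^{−(k−1)/2} = GL2Family.heckeLambda f n`
— the weight factor `d^{k−1}` of `cuspCoeff_mul_cuspCoeff` is absorbed by the normalisation.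
[cite: KowalskiMichelVanderKam2000, Lemma 3.1 (10) p. 8] -/
theorem heckeLambda_mul_heckeLambda (hf : IsNewform0 f) (m n : ℕ) :
    GL2Family.heckeLambda f m * GL2Family.heckeLambda f n =
      ∑ d ∈ (m.gcd n).divisors with d.Coprime N, GL2Family.heckeLambda f (m * n / d ^ 2) := by
  simp only [GL2Family.heckeLambda]
  rw [show cuspCoeff f m * (m : ℂ) ^ (-(((k : ℂ) - 1) / 2)) * (cuspCoeff f n * (n : ℂ) ^ (-(((k : ℂ) - 1) / 2))) =
      (cuspCoeff f m * cuspCoeff f n) * ((m : ℂ) ^ (-(((k : ℂ) - 1) / 2)) * (n : ℂ) ^ (-(((k : ℂ) - 1) / 2))) by ring,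
    ← Complex.natCast_mul_natCast_cpow, ← Nat.cast_mul, cuspCoeff_mul_cuspCoeff hf m n, Finset.sum_mul]
  refine Finset.sum_congr rfl fun d hd ↦ ?_
  have hd' : d ∈ (m.gcd n).divisors := (Finset.mem_filter.mp hd).1
  have hdg : d ∣ m.gcd n := Nat.dvd_of_mem_divisors hd'
  have hd0 : d ≠ 0 := Nat.pos_of_mem_divisors hd' |>.ne'
  rw [mul_right_comm,
    zpow_mul_natCast_mul_cpow_eq k hd0 (hdg.trans (Nat.gcd_dvd_left m n)) (hdg.trans (Nat.gcd_dvd_right m n)),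
    mul_comm]

/-- Analytic normalisation, coprime case: if `(gcd(m,n), N) = 1` (e.g. `(mn, N) = 1`, or `1 ≤ m < N` at prime level)
then `λ_f(m) λ_f(n) = Σ_{d ∣ gcd(m,n)} λ_f(mn/d²)` over ALL divisors (KMV 2000 p. 13: below the level «the trivial
character ε_q won't appear»). [cite: KowalskiMichelVanderKam2000, Lemma 3.1 (10) p. 8 with p. 13] -/
theorem heckeLambda_mul_heckeLambda_of_coprime (hf : IsNewform0 f) {m n : ℕ} (hmn : (m.gcd n).Coprime N) :
    GL2Family.heckeLambda f m * GL2Family.heckeLambda f n =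
      ∑ d ∈ (m.gcd n).divisors, GL2Family.heckeLambda f (m * n / d ^ 2) := by
  rw [heckeLambda_mul_heckeLambda hf, Finset.filter_true_of_mem]
  exact fun d hd ↦ Nat.Coprime.coprime_dvd_left (Nat.dvd_of_mem_divisors hd) hmn

/-- **Prime level** (the literal shape of KMV 2000, Lemma 3.1 (10): `ε_q(d) = 1` iff `q ∤ d`): for a prime level `q`,
a newform `f ∈ S_k(Γ₀(q))` and all `m, n : ℕ`, `λ_f(m) λ_f(n) = Σ_{d ∣ gcd(m,n), q ∤ d} λ_f(mn/d²)`.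
[cite: KowalskiMichelVanderKam2000, Lemma 3.1 (10) p. 8] -/
theorem heckeLambda_mul_heckeLambda_primeLevel {q : ℕ} [NeZero q] (hq : q.Prime) {k : ℤ} {f : CuspForm (Gamma0 q) k}
    (hf : IsNewform0 f) (m n : ℕ) :
    GL2Family.heckeLambda f m * GL2Family.heckeLambda f n =
      ∑ d ∈ (Nat.gcd m n).divisors.filter (fun d ↦ ¬ q ∣ d), GL2Family.heckeLambda f (m * n / d ^ 2) := by
  rw [heckeLambda_mul_heckeLambda hf m n]
  refine Finset.sum_congr (Finset.filter_congr fun d _ ↦ ?_) fun _ _ ↦ rfl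
  rw [Nat.coprime_comm, hq.coprime_iff_not_dvd]

end General

end Literature.NumberTheory.ModularForms

end
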